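import Literature.AlgebraicGeometry.Motives.HodgeThetaSubalgebraSymplecticRankTen
import Literature.AlgebraicGeometry.Motives.HodgeLieWeightOnePlusPairTwinSl2
import Literature.AlgebraicGeometry.Motives.HodgeLieWeightOnePlusPairTwinParity
import Literature.AlgebraicGeometry.Motives.HodgeLieWeightOnePlusPairSpanBranch
import HarnessLib

/-!
# `Lie Hg = 𝔰𝔭₁₀` for a weight-one polarized Hodge structure of rank `10` with `End_Hdg = ℚ`
# (Moonen–Zarhin 1999, (2.3)/(3.1) for simple abelian fivefolds of type I(1); Ribet, Tankeev)

Topic `Literature/AlgebraicGeometry/Motives` (namespace `Literature.AlgebraicGeometry.Motives.HodgeStructure`).  Theorems only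
(no definition, no named fact; D-0026).  Assembly of the programme R44 of the cell `pub-hodge-ring2` (literature lane gen 67;
honest framing of that cell: research route conditional on HC_CM; not a corollary; Q11.4-sentence-2 already refuted in dim ≥ 3 —
THIS file is an unconditional theorem about Hodge structures): `HodgeThetaSubalgebraSymplecticRankTen` (dichotomy: `𝔰𝔭` or a
plus pair), `HodgeLieWeightOnePlusLineSimple` (`𝔷 = 0`), `HodgeLieWeightOnePlusPairTwinIdeal` (`𝔥_ℂ ≤ 𝔰` or a twin ideal),
`…TwinSl2` + `…TwinParity` (twin ⟹ `4 ∣ dim V`), `…SpanBranch` (`𝔥_ℂ ≤ 𝔰` ⟹ `End(V^{1,0}) = ℂ`).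

* **`mem_hodgeLieC_of_skew_rankTen`** — `H` effective polarized of weight `1`, `dim_ℚ V = 10`, `End_Hdg(V) = ℚ`: every
  `ψ_ℂ`-skew endomorphism of `V_ℂ` lies in `Lie Hg(H) ⊗ ℂ`, i.e. `Hg(H) = Sp(V, ψ)`.  This is the case `g = 5`, `End⁰ = ℚ` of
  Moonen–Zarhin's theorem that a simple abelian variety of prime dimension with `End⁰ = ℚ` has `Hg = Sp` (Ribet / Tankeev).

## References

* [MoonenZarhin1999LowDim] B. Moonen, Yu. Zarhin, *Hodge classes on abelian varieties of low dimension* (1999), §2 (2.3), (3.1).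
* [Ribet1983] K. Ribet, *Hodge classes on certain types of abelian varieties*, Amer. J. Math. 105 (1983), Thm 1–2.
* [Deligne1982HodgeCycles] P. Deligne, *Hodge cycles on abelian varieties*, LNM 900 (1982), I §3.
-/

open scoped TensorProduct

namespace Literature.AlgebraicGeometry.Motives

open Module

universe u

variable {V : Type u} [AddCommGroup V] [Module ℚ V] [Module.Finite ℚ V] [HodgeTensorFacts.{u, u}] {n : ℤ}

namespace HodgeStructure

set_option maxHeartbeats 800000 in
/-- **`Lie Hg(H) ⊗ ℂ = 𝔰𝔭(V_ℂ, ψ_ℂ)` when `H` is effective polarized of weight `1`, `dim_ℚ V = 10` and `End_Hdg(V) = ℚ`.**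
By `SymplecticThetaTen.dichotomy` (applied to `𝔤 = Lie Hg`, admissible by `hodgeLie_standing`) either every skew operator is in
`𝔥_ℂ`, or `𝔥_ℂ` is in the plus-pair position; then `𝔷 = 0` (`hodgeLie_inf_endAlg_eq_bot_of_forall_endAlg_eq_smul`) and
`exists_twin_ideal_of_plusPair` leaves two cases, both absurd: `𝔥_ℂ ≤ ⟨B₀, C₀, Θ⟩` forces `End_ℂ(V^{1,0}) = ℂ`
(`forall_end_piece_eq_smul_of_hodgeLieC_le_span`) although `dim V^{1,0} = 5`; a twin `𝔰𝔩₂`-ideal forces `4 ∣ 10`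
(`exists_sl2Triple_of_twin`, `four_dvd_finrank_of_twin`). [cite: MoonenZarhin1999LowDim, §2 (2.3) and §3 (3.1)]
[cite: Ribet1983, Theorems 1–2] -/
theorem mem_hodgeLieC_of_skew_rankTen (H : HodgeStructure V n) (hn : n = 1) (heff : H.IsEffective) (ψ : H.Polarization)
    (hE : ∀ a ∈ H.endAlg, ∃ x : ℚ, a = x • (1 : Module.End ℚ V)) (hV : Module.finrank ℚ V = 10) :
    ∀ Y : Module.End ℂ (ℂ ⊗[ℚ] V),
      (∀ x y, ψ.form.baseChange ℂ (Y x) y + ψ.form.baseChange ℂ x (Y y) = 0) → Y ∈ H.hodgeLieC := by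
  classical
  obtain ⟨hbr, hskew, -, Θ, hΘ, hΘ𝔤⟩ := hodgeLie_standing H ψ
  rcases SymplecticThetaTen.dichotomy H hn heff ψ hE hV H.hodgeLie hbr hΘ hΘ𝔤 hskew with
    hall | ⟨B₀, hB₀, C₀, -, μ₀, hB₀0, hB₀P, hB₀im, hC₀, -, -, hμ₀, -, hBC, hCB, hline, hline'⟩
  · intro Y hY
    rw [hodgeLieC_eq_spanC]
    exact hall Y hY
  · exfalso
    rw [← hodgeLieC_eq_spanC] at hB₀ hline hline'
    have hz := hodgeLie_inf_endAlg_eq_bot_of_forall_endAlg_eq_smul H ψ hE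
    rcases exists_twin_ideal_of_plusPair H ψ hn heff hΘ hB₀ hB₀0 hB₀P hB₀im hC₀ hμ₀ hBC hCB hline hline' hz with
      hle | ⟨W, C, hWle, hCle, -, hWC, hW3, hWst, -, hcommWC, hW𝔰⟩
    · -- `𝔥_ℂ ≤ ⟨B₀, C₀, Θ⟩`: `End(V^{1,0})` would be `ℂ`, but `dim V^{1,0} = 5`
      have hscal := forall_end_piece_eq_smul_of_hodgeLieC_le_span H hn heff hΘ hB₀P hB₀im hC₀ hμ₀ hBC hCB hle hE
      have hP5 := (SymplecticThetaTen.finrank_pieces_eq_five H hn heff hV hΘ).1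
      let b := Module.finBasisOfFinrankEq ℂ (H.piece 1 0) hP5
      obtain ⟨c, hc⟩ := hscal ((b.coord 1).smulRight (b 0))
      have h1 := LinearMap.congr_fun hc (b 1)
      rw [LinearMap.smulRight_apply, Module.Basis.coord_apply, b.repr_self, Finsupp.single_eq_same, one_smul,
        LinearMap.smul_apply, Module.End.one_apply] at h1
      have h2 : (b.repr (b 0)) 0 = (b.repr (c • b 1)) 0 := by rw [h1]
      rw [b.repr_self, Finsupp.single_eq_same, map_smul, Finsupp.smul_apply, b.repr_self, Finsupp.single_apply,
        if_neg (by decide), smul_zero] at h2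
      exact one_ne_zero h2
    · -- a twin `sl₂`-ideal: `4 ∣ 10`
      have hΘ𝔰 : Θ ∈ Submodule.span ℂ (Set.range ![B₀, C₀, Θ]) := Submodule.subset_span ⟨2, rfl⟩
      have hC₀𝔰 : C₀ ∈ Submodule.span ℂ (Set.range ![B₀, C₀, Θ]) := Submodule.subset_span ⟨1, rfl⟩
      have hWΘ : ∀ w ∈ W, w * Θ = Θ * w := fun w hw => hW𝔰 w hw Θ hΘ𝔰
      have hWC₀ : ∀ w ∈ W, w * C₀ = C₀ * w := fun w hw => hW𝔰 w hw C₀ hC₀𝔰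
      obtain ⟨h', e', f', hh, he, hf, hHE, hHF, hEF, hspan⟩ := exists_sl2Triple_of_twin H ψ hn heff hΘ hB₀ hB₀0 hB₀P
        hB₀im hC₀ hμ₀ hBC hCB hline hline' hz hWle hCle hWC hW3 hWst hcommWC
      have h4 := four_dvd_finrank_of_twin H ψ hn heff hΘ hB₀ hB₀0 hB₀P hB₀im hC₀ hμ₀ hBC hCB hline hline' hz hWC hW3
        hcommWC hWΘ hWC₀ hh he hf hHE hHF hEF hspan
      rw [hV] at h4
      omega

end HodgeStructure

end Literature.AlgebraicGeometry.Motives
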